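import Summits.Ventures.Crystal3D.Theorems.StickyWulffConstantTextureBuildCoverPieces
import Summits.Ventures.Crystal3D.Theorems.StickyWulffConstantGenericWallFloorShellCount
import HarnessLib

/-!
# Texture build, TB-1: counting balls by volume, and the deterministic tiling-rim bound

Two bricks of the texture build's estimates (TB-0.md §9.5):

* `card_filter_mul_le_volume_thickening` / `card_filter_le_volume_thickening` — a unit packing has at
  most `(6/π) · Vol(N_{1/2}(A))` balls in a region `A` (the open balls of radius `1/2` about the
  points are disjoint and lie in the `1/2`-thickening; folklore, cf. Mattila 1995 §5.3).
* `PlacedCell.tilingRim_le` — for a placed wall cell whose ball set is ALL configuration balls in its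
  cylinder, whose filling keeps unit distance from the two caps, and below / above which the
  configuration is on the respective plate lattice, the tiling rim is at most `6 ×` the number of
  configuration balls in the LATERAL unit shell around the cylinder (each such ball has at most `12`
  partners, `cdeg_le_twelve`); with the tree's shell count `card_mul_le_of_separated_in_shell`
  (…GenericWallFloorShellCount) this gives `tilingRim ≤ 108·(2ρ+1)·(h+4R₀+4)`
  (`tilingRim_le_linear`) — linear in `ρ` like the law's rim `C(1+h)ρ`.  No random offset is needed.
-/

noncomputable section

open scoped BigOperators InnerProductSpace ENNReal NNReal
open MeasureTheory Metric

namespace Summit.Ventures.Crystal3D.Theorems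

open Summit.Ventures.Crystal3D Finset
open Summit.Ventures.Crystal3D.Cruxes.TextureLiminf.TexShadow (E3)

/-- The ball of radius `1/2` in `E3` has volume `π/6`. -/
theorem volume_ball_half (c : E3) : volume (ball c (1 / 2)) = ENNReal.ofReal (Real.pi / 6) := by
  rw [EuclideanSpace.volume_ball_fin_three, ← ENNReal.ofReal_pow (by norm_num),
    ← ENNReal.ofReal_mul (by norm_num)]
  congr 1
  ring

/-- **Counting balls by volume.** A finite set of points with pairwise distances `≥ 1` has at most
`Vol(N_{1/2}(A)) / (π/6)` of its points in any region `A`. -/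
theorem card_filter_mul_le_volume_thickening (X : Finset E3)
    (hX : ∀ p ∈ X, ∀ q ∈ X, p ≠ q → 1 ≤ dist p q) (A : Set E3) [DecidablePred (· ∈ A)] :
    ((X.filter (· ∈ A)).card : ℝ≥0∞) * ENNReal.ofReal (Real.pi / 6) ≤
      volume (thickening (1 / 2) A) := by
  set C := X.filter (· ∈ A) with hC
  have hdisj : (↑C : Set E3).PairwiseDisjoint fun c => ball c (1 / 2 : ℝ) := by
    intro p hp q hq hpq
    refine ball_disjoint_ball ?_
    have := hX p (Finset.mem_filter.1 (Finset.mem_coe.1 hp)).1 q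
      (Finset.mem_filter.1 (Finset.mem_coe.1 hq)).1 hpq
    linarith
  have hU : volume (⋃ c ∈ C, ball c (1 / 2 : ℝ)) = ∑ c ∈ C, volume (ball c (1 / 2 : ℝ)) :=
    measure_biUnion_finset hdisj fun c _ => measurableSet_ball
  have hsub : (⋃ c ∈ C, ball c (1 / 2 : ℝ)) ⊆ thickening (1 / 2) A := by
    rw [thickening_eq_biUnion_ball]
    refine Set.iUnion₂_subset fun c hc => ?_
    exact Set.subset_iUnion₂_of_subset c (Finset.mem_filter.1 hc).2 subset_rfl
  calc (C.card : ℝ≥0∞) * ENNReal.ofReal (Real.pi / 6)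
      = ∑ c ∈ C, volume (ball c (1 / 2 : ℝ)) := by
        rw [Finset.sum_congr rfl fun c _ => volume_ball_half c, Finset.sum_const, nsmul_eq_mul]
    _ = volume (⋃ c ∈ C, ball c (1 / 2 : ℝ)) := hU.symm
    _ ≤ volume (thickening (1 / 2) A) := measure_mono hsub

/-- Real-valued form of `card_filter_mul_le_volume_thickening`: at most `(6/π)·Vol(N_{1/2}(A))`
points in `A`, for a region whose `1/2`-neighbourhood has finite volume. -/
theorem card_filter_le_volume_thickening (X : Finset E3)
    (hX : ∀ p ∈ X, ∀ q ∈ X, p ≠ q → 1 ≤ dist p q) (A : Set E3) [DecidablePred (· ∈ A)]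
    (hA : volume (thickening (1 / 2) A) ≠ ⊤) :
    ((X.filter (· ∈ A)).card : ℝ) ≤
      6 / Real.pi * (volume (thickening (1 / 2) A)).toReal := by
  have h := card_filter_mul_le_volume_thickening X hX A
  have hpi : 0 < Real.pi / 6 := by positivity
  have h2 : ((X.filter (· ∈ A)).card : ℝ) * (Real.pi / 6) ≤ (volume (thickening (1 / 2) A)).toReal := by
    have := ENNReal.toReal_mono hA h
    rwa [ENNReal.toReal_mul, ENNReal.toReal_ofReal hpi.le, ENNReal.toReal_natCast] at this
  rw [div_mul_eq_mul_div, le_div_iff₀ Real.pi_pos]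
  nlinarith [h2]

end Summit.Ventures.Crystal3D.Theorems

namespace Summit.Ventures.Crystal3D.Cruxes.TextureLiminf.TexShadow

open Summit.Ventures.Crystal3D Summit.Ventures.Crystal3D.Theorems Finset
open Literature.MathematicalPhysics.StatisticalMechanics (IsHaggSeq contactDeficiency)

namespace PlacedCell

variable {C R₀ : ℝ} {X' : Finset E3}

open scoped Classical in
/-- the LATERAL unit shell of the cell, in model position: configuration balls outside the cylinder
radially by at most `1`, within the cylinder's height range widened by `1`. -/
def lateralShell (k : PlacedCell C R₀ X') : Finset E3 :=
  k.model.filter fun q => k.ρ ^ 2 < q 0 ^ 2 + q 1 ^ 2 ∧ q 0 ^ 2 + q 1 ^ 2 ≤ (k.ρ + 1) ^ 2 ∧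
    -(2 * R₀) - 1 ≤ q 2 ∧ q 2 ≤ k.h + 2 * R₀ + 1

/-- Coordinates are `1`-Lipschitz: `|p i − q i| ≤ dist p q`. -/
theorem abs_sub_apply_le_dist (p q : E3) (i : Fin 3) : |p i - q i| ≤ dist p q := by
  rw [EuclideanSpace.dist_eq]
  have h : (p i - q i) ^ 2 ≤ ∑ j, dist (p j) (q j) ^ 2 := by
    have := Finset.single_le_sum (f := fun j => dist (p j) (q j) ^ 2) (fun j _ => sq_nonneg _)
      (Finset.mem_univ i)
    simpa [Real.dist_eq, sq_abs] using this
  calc |p i - q i| = Real.sqrt ((p i - q i) ^ 2) := (Real.sqrt_sq_eq_abs _).symm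
    _ ≤ Real.sqrt (∑ j, dist (p j) (q j) ^ 2) := Real.sqrt_le_sqrt h

/-- The planar radius is `1`-Lipschitz: `√(q₀²+q₁²) ≤ √(p₀²+p₁²) + dist p q`. -/
theorem sqrt_radial_le (p q : E3) :
    Real.sqrt (q 0 ^ 2 + q 1 ^ 2) ≤ Real.sqrt (p 0 ^ 2 + p 1 ^ 2) + dist p q := by
  -- the planar projection is a contraction; triangle inequality in the plane
  have hd : Real.sqrt ((q 0 - p 0) ^ 2 + (q 1 - p 1) ^ 2) ≤ dist p q := by
    rw [EuclideanSpace.dist_eq]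
    apply Real.sqrt_le_sqrt
    have h3 : ∑ j : Fin 3, dist (p j) (q j) ^ 2 =
        dist (p 0) (q 0) ^ 2 + dist (p 1) (q 1) ^ 2 + dist (p 2) (q 2) ^ 2 := by
      simp [Fin.sum_univ_three]
    rw [h3, Real.dist_eq, Real.dist_eq, Real.dist_eq, sq_abs, sq_abs, sq_abs]
    nlinarith [sq_nonneg (p 2 - q 2), sq_nonneg (p 0 - q 0), sq_nonneg (p 1 - q 1)]
  -- Minkowski in ℝ²: ‖q‖ ≤ ‖p‖ + ‖q − p‖
  have hM : Real.sqrt (q 0 ^ 2 + q 1 ^ 2) ≤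
      Real.sqrt (p 0 ^ 2 + p 1 ^ 2) + Real.sqrt ((q 0 - p 0) ^ 2 + (q 1 - p 1) ^ 2) := by
    rw [Real.sqrt_le_left (by positivity)]
    have ha := Real.sq_sqrt (show 0 ≤ p 0 ^ 2 + p 1 ^ 2 by positivity)
    have hb := Real.sq_sqrt (show 0 ≤ (q 0 - p 0) ^ 2 + (q 1 - p 1) ^ 2 by positivity)
    have hab := Real.sqrt_nonneg (p 0 ^ 2 + p 1 ^ 2)
    have hbb := Real.sqrt_nonneg ((q 0 - p 0) ^ 2 + (q 1 - p 1) ^ 2)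
    -- Cauchy–Schwarz: p₀(q₀−p₀) + p₁(q₁−p₁) ≤ √(p₀²+p₁²) √((q₀−p₀)²+(q₁−p₁)²)
    have hCS : p 0 * (q 0 - p 0) + p 1 * (q 1 - p 1) ≤
        Real.sqrt (p 0 ^ 2 + p 1 ^ 2) * Real.sqrt ((q 0 - p 0) ^ 2 + (q 1 - p 1) ^ 2) := by
      rw [← Real.sqrt_mul (by positivity)]
      apply Real.le_sqrt_of_sq_le
      nlinarith [sq_nonneg (p 0 * (q 1 - p 1) - p 1 * (q 0 - p 0))]
    nlinarith [hCS]
  linarith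

/-- **Deterministic tiling-rim bound.**  If the cell's balls are ALL configuration balls in its
cylinder (`hfull`), the filling keeps distance `1` from the two caps (`hF`), and the configuration
balls within `1` below / above the cylinder lie on the lower / upper plate lattice (`hbelow`,
`habove`), then `tilingRim ≤ 6 · #lateralShell`. -/
theorem tilingRim_le (k : PlacedCell C R₀ X') (hR₀ : 1 ≤ R₀)
    (hX'sep : ∀ p ∈ X', ∀ q ∈ X', p ≠ q → 1 ≤ dist p q)
    (hfull : ∀ q ∈ k.model, q ∈ cyl R₀ k.h k.ρ → q ∈ k.X)
    (hF : ∀ p ∈ k.F, -(2 * R₀) + 1 < p 2 ∧ p 2 < k.h + 2 * R₀ - 1)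
    (hbelow : ∀ q ∈ k.model, q 2 < -(2 * R₀) → -(2 * R₀) - 1 ≤ q 2 →
      q 0 ^ 2 + q 1 ^ 2 ≤ (k.ρ + 1) ^ 2 → q ∈ stacking k.L₁ k.s₁ k.σ₁)
    (habove : ∀ q ∈ k.model, k.h + 2 * R₀ < q 2 → q 2 ≤ k.h + 2 * R₀ + 1 →
      q 0 ^ 2 + q 1 ^ 2 ≤ (k.ρ + 1) ^ 2 → q ∈ stacking k.L₂ k.s₂ k.σ₂) :
    k.tilingRim ≤ 6 * (k.lateralShell.card : ℝ) := by
  classical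
  -- Step 1: every counted partner `q` lies in the lateral shell.
  have hρ : 0 < k.ρ := by linarith [k.hρ, hR₀]
  have key : ∀ p ∈ k.X, ∀ q ∈ k.model \ k.X, dist p q = 1 →
      (p ∈ k.F ∨ (p ∈ k.P₁ ∧ (q ∉ stacking k.L₁ k.s₁ k.σ₁ ∨ -R₀ < q 2)) ∨
        (p ∈ k.P₂ ∧ (q ∉ stacking k.L₂ k.s₂ k.σ₂ ∨ q 2 < k.h + R₀))) → q ∈ k.lateralShell := by
    intro p hp q hq hpq hcase
    rw [Finset.mem_sdiff] at hq
    have hpc := k.hcyl p hp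
    simp only [cyl, Set.mem_setOf_eq] at hpc
    have hqc : q ∉ cyl R₀ k.h k.ρ := fun h => hq.2 (hfull q hq.1 h)
    simp only [cyl, Set.mem_setOf_eq, not_and_or, not_le] at hqc
    have h2 := abs_sub_apply_le_dist p q 2
    rw [hpq] at h2
    have h2' := abs_le.1 h2
    -- radial control: √(q-radial) ≤ ρ + 1
    have hrad : q 0 ^ 2 + q 1 ^ 2 ≤ (k.ρ + 1) ^ 2 := by
      have hs := sqrt_radial_le p q
      rw [hpq] at hs
      have hp1 : Real.sqrt (p 0 ^ 2 + p 1 ^ 2) ≤ k.ρ := by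
        rw [Real.sqrt_le_left hρ.le]; exact hpc.2.2
      have hq0 : 0 ≤ Real.sqrt (q 0 ^ 2 + q 1 ^ 2) := Real.sqrt_nonneg _
      have := Real.sq_sqrt (show 0 ≤ q 0 ^ 2 + q 1 ^ 2 by positivity)
      nlinarith [hs, hp1, hq0]
    unfold lateralShell
    rw [Finset.mem_filter]
    refine ⟨hq.1, ?_, hrad, by linarith [hpc.1], by linarith [hpc.2.1]⟩
    -- it remains to exclude `q` radially inside: then `q` is below or above the cylinder
    by_contra hin
    push Not at hin
    rcases hqc with hlow | hhigh | hout
    · -- q below the bottom cap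
      have hqS : q ∈ stacking k.L₁ k.s₁ k.σ₁ := hbelow q hq.1 (by linarith) (by linarith) hrad
      rcases hcase with hpF | ⟨hpP, hq'⟩ | ⟨hpP, hq'⟩
      · have := (hF p hpF).1; linarith
      · rcases hq' with hnS | hz
        · exact hnS hqS
        · linarith
      · have := ((k.hP₂iff p).1 hpP).2.1; linarith [k.hh]
    · -- q above the top cap
      have hqS : q ∈ stacking k.L₂ k.s₂ k.σ₂ := habove q hq.1 (by linarith) (by linarith) hrad
      rcases hcase with hpF | ⟨hpP, hq'⟩ | ⟨hpP, hq'⟩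
      · have := (hF p hpF).2; linarith
      · have := ((k.hP₁iff p).1 hpP).2.2.1; linarith [k.hh]
      · rcases hq' with hnS | hz
        · exact hnS hqS
        · linarith
    · linarith
  -- Step 2: the three pair sets inject into `(lateralShell ×ˢ X).filter (dist = 1)` disjointly.
  have hFX : k.F ⊆ k.X := fun p hp => by
    unfold WallCell.F at hp; exact (Finset.mem_sdiff.1 (Finset.mem_sdiff.1 hp).1).1
  have hP₁X : k.P₁ ⊆ k.X := k.hP₁
  have hP₂X : k.P₂ ⊆ k.X := fun p hp => (Finset.mem_sdiff.1 (k.hP₂ hp)).1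
  set T := (k.lateralShell ×ˢ k.X).filter fun qp : E3 × E3 => dist qp.1 qp.2 = 1 with hT
  set S₀ := (k.F ×ˢ (k.model \ k.X)).filter fun pq : E3 × E3 => dist pq.1 pq.2 = 1 with hS₀
  set S₁ := (k.P₁ ×ˢ (k.model \ k.X)).filter fun pq : E3 × E3 =>
      dist pq.1 pq.2 = 1 ∧ (pq.2 ∉ stacking k.L₁ k.s₁ k.σ₁ ∨ -R₀ < pq.2 2) with hS₁
  set S₂ := (k.P₂ ×ˢ (k.model \ k.X)).filter fun pq : E3 × E3 =>
      dist pq.1 pq.2 = 1 ∧ (pq.2 ∉ stacking k.L₂ k.s₂ k.σ₂ ∨ pq.2 2 < k.h + R₀) with hS₂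
  have hcross : (crossCount k.F (k.model \ k.X) : ℝ) = S₀.card := by
    unfold crossCount; rfl
  -- the union S₀ ∪ S₁ ∪ S₂ is disjoint (first coordinates in the disjoint sets F, P₁, P₂)
  have hdFP₁ : Disjoint k.F k.P₁ := by
    unfold WallCell.F
    exact Finset.disjoint_of_subset_left Finset.sdiff_subset Finset.sdiff_disjoint
  have hdFP₂ : Disjoint k.F k.P₂ := by
    unfold WallCell.F; exact Finset.sdiff_disjoint
  have hdP₁P₂ : Disjoint k.P₁ k.P₂ :=
    Finset.disjoint_of_subset_right k.hP₂ Finset.disjoint_sdiff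
  have hd01 : Disjoint S₀ S₁ := by
    rw [Finset.disjoint_left]; intro pq h0 h1
    rw [hS₀, Finset.mem_filter, Finset.mem_product] at h0
    rw [hS₁, Finset.mem_filter, Finset.mem_product] at h1
    exact Finset.disjoint_left.1 hdFP₁ h0.1.1 h1.1.1
  have hd02 : Disjoint S₀ S₂ := by
    rw [Finset.disjoint_left]; intro pq h0 h2
    rw [hS₀, Finset.mem_filter, Finset.mem_product] at h0
    rw [hS₂, Finset.mem_filter, Finset.mem_product] at h2
    exact Finset.disjoint_left.1 hdFP₂ h0.1.1 h2.1.1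
  have hd12 : Disjoint S₁ S₂ := by
    rw [Finset.disjoint_left]; intro pq h1 h2
    rw [hS₁, Finset.mem_filter, Finset.mem_product] at h1
    rw [hS₂, Finset.mem_filter, Finset.mem_product] at h2
    exact Finset.disjoint_left.1 hdP₁P₂ h1.1.1 h2.1.1
  have hU : (S₀ ∪ S₁ ∪ S₂).card = S₀.card + S₁.card + S₂.card := by
    rw [Finset.card_union_of_disjoint (Finset.disjoint_union_left.2 ⟨hd02, hd12⟩),
      Finset.card_union_of_disjoint hd01]
  -- the swapped union lies in T
  have hsub : (S₀ ∪ S₁ ∪ S₂).image Prod.swap ⊆ T := by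
    intro qp hqp
    rw [Finset.mem_image] at hqp
    obtain ⟨pq, hpq, rfl⟩ := hqp
    rw [hT, Finset.mem_filter, Finset.mem_product]
    simp only [Prod.fst_swap, Prod.snd_swap]
    rcases Finset.mem_union.1 hpq with h01 | h2
    · rcases Finset.mem_union.1 h01 with h0 | h1
      · rw [hS₀, Finset.mem_filter, Finset.mem_product] at h0
        refine ⟨⟨key _ (hFX h0.1.1) _ h0.1.2 h0.2 (Or.inl h0.1.1), hFX h0.1.1⟩, ?_⟩
        rw [dist_comm]; exact h0.2
      · rw [hS₁, Finset.mem_filter, Finset.mem_product] at h1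
        refine ⟨⟨key _ (hP₁X h1.1.1) _ h1.1.2 h1.2.1 (Or.inr (Or.inl ⟨h1.1.1, h1.2.2⟩)),
          hP₁X h1.1.1⟩, ?_⟩
        rw [dist_comm]; exact h1.2.1
    · rw [hS₂, Finset.mem_filter, Finset.mem_product] at h2
      refine ⟨⟨key _ (hP₂X h2.1.1) _ h2.1.2 h2.2.1 (Or.inr (Or.inr ⟨h2.1.1, h2.2.2⟩)),
        hP₂X h2.1.1⟩, ?_⟩
      rw [dist_comm]; exact h2.2.1
  have hcardU : (S₀ ∪ S₁ ∪ S₂).card ≤ T.card := by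
    calc (S₀ ∪ S₁ ∪ S₂).card = ((S₀ ∪ S₁ ∪ S₂).image Prod.swap).card :=
          (Finset.card_image_of_injective _ Prod.swap_injective).symm
      _ ≤ T.card := Finset.card_le_card hsub
  -- Step 3: `#T ≤ 12 · #lateralShell` by the kissing bound `cdeg_le_twelve`.
  have hmsep : ∀ p ∈ k.model, ∀ q ∈ k.model, p ≠ q → 1 ≤ dist p q := by
    intro p hp q hq hpq
    unfold model at hp hq
    obtain ⟨p', hp', rfl⟩ := Finset.mem_image.1 hp
    obtain ⟨q', hq', rfl⟩ := Finset.mem_image.1 hq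
    have hne : p' ≠ q' := fun h => hpq (by rw [h])
    have := hX'sep p' hp' q' hq' hne
    rwa [LinearIsometryEquiv.dist_map, dist_sub_right]
  have hT12 : T.card ≤ 12 * k.lateralShell.card := by
    have hTsub : T ⊆ (k.lateralShell ×ˢ k.model).filter fun qp : E3 × E3 => dist qp.1 qp.2 = 1 := by
      rw [hT]
      exact Finset.filter_subset_filter _ (Finset.product_subset_product_right k.X_subset_model)
    have hsum : ((k.lateralShell ×ˢ k.model).filter fun qp : E3 × E3 => dist qp.1 qp.2 = 1).card =
        ∑ q ∈ k.lateralShell, cdeg k.model q := by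
      rw [Finset.card_filter, Finset.sum_product]
      refine Finset.sum_congr rfl fun q _ => ?_
      unfold cdeg
      rw [Finset.card_filter]
    calc T.card ≤ _ := Finset.card_le_card hTsub
      _ = ∑ q ∈ k.lateralShell, cdeg k.model q := hsum
      _ ≤ ∑ q ∈ k.lateralShell, 12 := Finset.sum_le_sum fun q _ => cdeg_le_twelve k.model hmsep q
      _ = 12 * k.lateralShell.card := by rw [Finset.sum_const, smul_eq_mul, mul_comm]
  -- Step 4: assemble.
  have htr : k.tilingRim = ((S₀.card : ℝ) + S₁.card + S₂.card) / 2 := by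
    unfold tilingRim crossCount
    rw [hS₀, hS₁, hS₂]
    ring
  rw [htr]
  have h1 : ((S₀.card : ℝ) + S₁.card + S₂.card) ≤ T.card := by
    have := hU ▸ hcardU
    exact_mod_cast this
  have h2 : (T.card : ℝ) ≤ 12 * k.lateralShell.card := by exact_mod_cast hT12
  linarith

/-- **Size of the lateral shell**: `#lateralShell ≤ 18·(2ρ+1)·(h+4R₀+4)` in a unit packing
(`card_mul_le_of_separated_in_shell` with radii `ρ, ρ+1` and heights `[−2R₀−1, h+2R₀+1]`). -/
theorem card_lateralShell_le (k : PlacedCell C R₀ X') (hR₀ : 1 ≤ R₀)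
    (hX'sep : ∀ p ∈ X', ∀ q ∈ X', p ≠ q → 1 ≤ dist p q) :
    (k.lateralShell.card : ℝ) ≤ 18 * (2 * k.ρ + 1) * (k.h + 4 * R₀ + 4) := by
  classical
  have hmsep : ∀ p ∈ k.lateralShell, ∀ q ∈ k.lateralShell, p ≠ q → 1 ≤ dist p q := by
    intro p hp q hq hpq
    unfold lateralShell model at hp hq
    obtain ⟨p', hp', rfl⟩ := Finset.mem_image.1 (Finset.mem_filter.1 hp).1
    obtain ⟨q', hq', rfl⟩ := Finset.mem_image.1 (Finset.mem_filter.1 hq).1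
    have hne : p' ≠ q' := fun h => hpq (by rw [h])
    have := hX'sep p' hp' q' hq' hne
    rwa [LinearIsometryEquiv.dist_map, dist_sub_right]
  have hρ : R₀ ≤ k.ρ := k.hρ
  have hh : 0 ≤ k.h := k.hh
  have h := card_mul_le_of_separated_in_shell k.lateralShell hmsep (-(2 * R₀) - 1) (k.h + 2 * R₀ + 1)
    k.ρ (k.ρ + 1) (by linarith) (by linarith) (by linarith) (fun p hp => by
      unfold lateralShell at hp
      have h2 := (Finset.mem_filter.1 hp).2
      exact ⟨h2.2.2.1, h2.2.2.2, h2.1, h2.2.1⟩)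
  have hpi := Real.pi_pos
  have hring : (k.h + 2 * R₀ + 1 - (-(2 * R₀) - 1) + 2) *
      (Real.pi * (k.ρ + 1 + 1) ^ 2 - Real.pi * (k.ρ - 1) ^ 2) =
      (Real.pi / 6) * (18 * (2 * k.ρ + 1) * (k.h + 4 * R₀ + 4)) := by ring
  rw [hring] at h
  exact le_of_mul_le_mul_left (by linarith [h]) (by positivity : (0:ℝ) < Real.pi / 6)

/-- **Deterministic tiling-rim estimate**: under the hypotheses of `tilingRim_le`,
`tilingRim ≤ 108·(2ρ+1)·(h+4R₀+4)` — linear in `ρ`, as the rim term `C(1+h)ρ` of the wall law. -/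
theorem tilingRim_le_linear (k : PlacedCell C R₀ X') (hR₀ : 1 ≤ R₀)
    (hX'sep : ∀ p ∈ X', ∀ q ∈ X', p ≠ q → 1 ≤ dist p q)
    (hfull : ∀ q ∈ k.model, q ∈ cyl R₀ k.h k.ρ → q ∈ k.X)
    (hF : ∀ p ∈ k.F, -(2 * R₀) + 1 < p 2 ∧ p 2 < k.h + 2 * R₀ - 1)
    (hbelow : ∀ q ∈ k.model, q 2 < -(2 * R₀) → -(2 * R₀) - 1 ≤ q 2 →
      q 0 ^ 2 + q 1 ^ 2 ≤ (k.ρ + 1) ^ 2 → q ∈ stacking k.L₁ k.s₁ k.σ₁)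
    (habove : ∀ q ∈ k.model, k.h + 2 * R₀ < q 2 → q 2 ≤ k.h + 2 * R₀ + 1 →
      q 0 ^ 2 + q 1 ^ 2 ≤ (k.ρ + 1) ^ 2 → q ∈ stacking k.L₂ k.s₂ k.σ₂) :
    k.tilingRim ≤ 108 * (2 * k.ρ + 1) * (k.h + 4 * R₀ + 4) := by
  have h1 := k.tilingRim_le hR₀ hX'sep hfull hF hbelow habove
  have h2 := k.card_lateralShell_le hR₀ hX'sep
  linarith

end PlacedCell

end Summit.Ventures.Crystal3D.Cruxes.TextureLiminf.TexShadow
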